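import Summits.HodgeConjecture.HodgeConjecture.Theorems.LimitExtensionMiddleDivisorSupportSufficesSNCBridgeResolution
import Summits.HodgeConjecture.HodgeConjecture.Theorems.LimitExtensionMiddleDivisorSupportSufficesSNCBridgeCohomology
import Summits.HodgeConjecture.HodgeConjecture.Theorems.LimitExtensionMiddleDivisorSupportSufficesModification
import Literature.AlgebraicGeometry.Resolution.LogResolutionOfClosedSubset
import HarnessLib

/-!
# Route LimitExtension · `MiddleDivisorSupportSuffices` (stmt-HodgeConjecture-10865):
# the item from the snc principle of two types and the pencil crux

Final assembly of the snc bridge (`…SNCBridgeResolution.lean`, `…SNCBridgeCohomology.lean`,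
`…Modification.lean`): the modification data are assembled from a projective log resolution
(`modification827_of_snc827_of_logResolution`, hypothesis `hLog`), and `hLog` is DISCHARGED here
from the tree's proved log resolution (`Resolution.exists_logResolution_of_isClosed`, Kollár
Thm. 3.21 via `Kollar2007MarkedOrderReduction_holds`) re-run keeping track of projectivity
(`isProjectiveOver_of_isMultipleBlowup`, Hartshorne II 7.16 (c)). Consequently the item
`MiddleDivisorSupportSuffices` — and route decl `DivisorInduction` (stmt-HodgeConjecture-1082) —
follow from the pencil crux `PencilReduction` (stmt-HodgeConjecture-1083) and ONE Hodge-theoretic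
statement strictly weaker than the named fact `Deligne1974_ker_pullback_eq_ker_pullback_resolution`
(Prop. 8.2.7 for ARBITRARY families): the snc principle of two types `hS` (Prop. 8.2.7 for the
members of an snc boundary; Deligne–Griffiths–Morgan–Sullivan 1975 §5–§6, Griffiths–Schmid 1975
§4), which is what the tree's `∂∂̄` road (`Literature.Algebra.Homology.DDbarCechSystem.exists_zigzag`,
`Literature.NumberTheory.Transcendental.ddbar_of_exact`) proves first.

Main results: `exists_logResolution_isProjectiveOver` (projective log resolution),
`modification827_of_snc827_of_logResolution` (assembly), `modification827_of_snc827`,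
`divisorInduction_of_snc827`, `middleDivisorSupportSuffices_of_snc827`. No definitions, no named facts.

## References

* [Kollar2007] J. Kollár, Lectures on Resolution of Singularities (2007), Thm. 3.21, Thm. 3.69, 3.72.
* [Hartshorne1977] R. Hartshorne, Algebraic Geometry (1977), II Prop. 7.16 (c).
* [DeligneGriffithsMorganSullivan1975] P. Deligne, P. Griffiths, J. Morgan, D. Sullivan, Real
  homotopy theory of Kähler manifolds, Invent. Math. 29 (1975), §5–§6.
* [DeligneHodgeIII1974] P. Deligne, Théorie de Hodge III, Publ. Math. IHÉS 44 (1974), Prop. 8.2.7.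
* [Thomas2005Nodes] R. Thomas, Nodes and the Hodge conjecture, J. Algebraic Geom. 14 (2005), Prop. 2.
-/

-- `Summit.HodgeConjecture.HodgeConjecture.Theorems` is the mandated namespace (single-conjunct summit:
-- Sub = Summit), which `linter.dupNamespace` flags; off tree-wide in the lakefile, restated here so
-- stand-alone elaboration is warning-free too.
set_option linter.dupNamespace false

noncomputable section

open CategoryTheory CategoryTheory.Limits AlgebraicGeometry TopologicalSpace
open MonoidalCategory CartesianMonoidalCategory
open Literature.AlgebraicTopology.SingularHomology
open Literature.AlgebraicGeometry.Resolution Literature.AlgebraicGeometry.Motives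
open Literature.AlgebraicGeometry.HodgeTheory
open Summit.HodgeConjecture.HodgeConjecture.Theses.LimitExtension

namespace Summit.HodgeConjecture.HodgeConjecture.Theorems

universe u

/-! ### Projective log resolution -/

/-- **Log resolution of a closed subset of a regular PROJECTIVE variety, with projective total
space** (Kollár Thm. 3.21 via the tree's proved order reduction `Kollar2007MarkedOrderReduction_holds`,
exactly as `Resolution.exists_logResolution_of_isClosed`, keeping track of projectivity through
`isProjectiveOver_of_isMultipleBlowup`): for `W` regular, integral and projective over a field `k`
of characteristic zero and `Z ⊊ W` closed there are an integral regular `W'`, `Π : W' → W` an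
isomorphism over `W ∖ Z`, with `W'` projective over `k` (structure map `Π ≫ s`), and an snc
boundary `E` on `W'` with `Π⁻¹(Z) = ⋃_{D ∈ E} V(D)`.
[cite: Kollar2007, Thm. 3.21 (p. 124), Thm. 3.69 (p. 150), 3.72 (p. 152)]
[cite: Hartshorne1977, II Prop. 7.16 (c)] -/
theorem exists_logResolution_isProjectiveOver {k : Type u} [Field k] [CharZero k] {W : Scheme.{u}}
    (s : W ⟶ Spec (.of k)) (hproj : IsProjectiveOver (Over.mk s))
    [IsIntegral W] (hW : Scheme.IsRegular W) {Z : Set W} (hZ : IsClosed Z)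
    (hZne : Z ≠ Set.univ) :
    ∃ (W' : Scheme.{u}) (f : W' ⟶ W) (E : List W'.IdealSheafData),
      IsIntegral W' ∧ Scheme.IsRegular W' ∧
      IsIso (f ∣_ ⟨Zᶜ, hZ.isOpen_compl⟩) ∧ HasSNC E ∧
      f ⁻¹' Z = ⋃ D ∈ E, (D.support : Set W') ∧
      IsProjectiveOver (Over.mk (f ≫ s)) := by
  haveI : IsProper s := IsProjectiveOver.isProper (X := Over.mk s) hproj
  haveI : IsLocallyNoetherian W := LocallyOfFiniteType.isLocallyNoetherian s
  -- the (radical) ideal of `Z`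
  set I : W.IdealSheafData := Scheme.IdealSheafData.vanishingIdeal ⟨Z, hZ⟩ with hIdef
  have hIsupp : (I.support : Set W) = Z := by
    rw [hIdef, Scheme.IdealSheafData.coe_support_vanishingIdeal]; rfl
  have hI : I ≠ ⊥ := by
    intro h0
    apply hZne
    rw [← hIsupp, h0, Scheme.IdealSheafData.support_bot]
    rfl
  -- order reduction for `(W, 𝓘_Z, ∅, 1)`
  obtain ⟨W', f, M', hres⟩ :=
    Kollar2007MarkedOrderReduction_holds k W s inferInstance inferInstance inferInstance ‹_› hW I hI
      1 le_rfl
  have hmb : IsMultipleBlowup (⟨I, [], 1⟩ : MarkedIdeal W) f M' := hres.1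
  refine ⟨W', f, M'.boundary, (hmb.isIntegral_and_ideal_ne_bot hI le_rfl).1,
    hmb.isRegular hW, ?_, hmb.hasSNC_boundary (hasSNC_nil_of_isRegular hW), ?_,
    isProjectiveOver_of_isMultipleBlowup s hproj hmb⟩
  · -- isomorphism over `W ∖ Z = W ∖ cosupp 𝓘_Z`
    have hiso := hmb.isIso_morphismRestrict le_rfl
    have hU : (⟨Zᶜ, hZ.isOpen_compl⟩ : W.Opens) =
        ⟨((⟨I, [], 1⟩ : MarkedIdeal W).ideal.support : Set W)ᶜ,
          (⟨I, [], 1⟩ : MarkedIdeal W).ideal.support.isClosed.isOpen_compl⟩ := by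
      ext1
      show Zᶜ = (I.support : Set W)ᶜ
      rw [hIsupp]
    rw [hU]
    exact hiso
  · -- `f⁻¹ Z = ⋃ V(E_i)`: the final controlled transform is the unit ideal
    have key := hmb.preimage_support_union_eq rfl
    have htop : M'.ideal = ⊤ := hres.ideal_eq_top rfl
    simp only [List.not_mem_nil, Set.iUnion_of_empty, Set.iUnion_empty, Set.union_empty, htop,
      Scheme.IdealSheafData.support_top] at key
    rw [show ((⟨I, [], 1⟩ : MarkedIdeal W).ideal.support : Set W) = Z from hIsupp] at key
    rw [key]
    simp

/-! ### Step F: assembly — the modification data from a projective log resolution and the snc principle -/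

/-- **Modification data from the snc principle of two types, granted a projective log resolution.**
Hypotheses: `hLog`, log resolution of a closed `Z ⊊ W` in a regular integral projective `ℂ`-scheme
into an snc boundary with PROJECTIVE total space (the tree's `Resolution.exists_logResolution_of_isClosed`,
Kollár Thm. 3.21, plus projectivity of the iterated blow-up, Hartshorne II 7.16 (c) — supplied by
the companion file once that module is available on the farm); `hS`, the snc principle of two
types (Deligne–Griffiths–Morgan–Sullivan §5–§6 / Griffiths–Schmid §4 / the snc case of Deligne's
Prop. 8.2.7): on a smooth projective complex variety a class restricting to zero on the complex
points of every member of an snc boundary vanishes on a neighbourhood of their union. Conclusion: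
the modification data `hMod` of `divisorInduction_of_modification827` /
`middleDivisorSupportSuffices_of_modification827` (file `…Modification.lean`): resolve `Z`
(`hLog`), read the total space as a birational morphism of smooth projective `(n+1)`-folds
(`isSmoothProjective_and_isBirational_of_modification`), take the components of the boundary as
closed immersions of smooth projective varieties (`exists_family_of_hasSNC`), get Prop. 8.2.7 for
them from `hS` (`pullback827_of_snc`) and pad them to `n`-folds (`exists_padded_family`).
[cite: Kollar2007, Thm. 3.21 (p. 124)] [cite: DeligneGriffithsMorganSullivan1975, §5–§6]
[cite: DeligneHodgeIII1974, Prop. 8.2.7] [cite: BrosnanFangNiePearlstein2009, §6 Lemma 48] -/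
theorem modification827_of_snc827_of_logResolution
    (hLog : ∀ ⦃W : Scheme.{0}⦄ (s : W ⟶ Spec (.of ℂ)), IsProjectiveOver (Over.mk s) →
      IsIntegral W → Scheme.IsRegular W → ∀ ⦃Z : Set W⦄ (hZ : IsClosed Z), Z ≠ Set.univ →
      ∃ (W' : Scheme.{0}) (f : W' ⟶ W) (E : List W'.IdealSheafData),
        IsIntegral W' ∧ Scheme.IsRegular W' ∧ IsIso (f ∣_ ⟨Zᶜ, hZ.isOpen_compl⟩) ∧ HasSNC E ∧
        f ⁻¹' Z = ⋃ D ∈ E, ((D.support : Set W')) ∧ IsProjectiveOver (Over.mk (f ≫ s)))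
    (hS : ∀ ⦃n : ℕ⦄ ⦃X : SchemeOver ℂ⦄, IsSmoothProjective n X →
      ∀ (E : List X.left.IdealSheafData), HasSNC E → ∀ (q : ℕ) (x' : complexBetti X q),
      (∀ D ∈ E, singularCohomology.map ℂ ℂ
        (subsetIncl {Q : ComplexPoints X | Q.pt ∈ ((D.support : Set X.left))}) q x' = 0) →
      ∃ V : Set (ComplexPoints X), IsOpen V ∧
        {Q : ComplexPoints X | Q.pt ∈ ⋃ D ∈ E, ((D.support : Set X.left))} ⊆ V ∧
        singularCohomology.map ℂ ℂ (subsetIncl V) q x' = 0) :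
    ∀ ⦃n : ℕ⦄ ⦃X : SchemeOver ℂ⦄, IsSmoothProjective (n + 1) X → ∀ ⦃Z : Set X.left⦄,
      IsClosed Z → (∀ z ∈ Z, (1 : ℕ∞) ≤ Order.coheight z) →
      ∃ (X' : SchemeOver ℂ) (_ : IsSmoothProjective (n + 1) X') (π : X' ⟶ X)
        (_ : Literature.AlgebraicGeometry.Resolution.IsBirational π.left)
        (ι : Type) (_ : Finite ι) (E : ι → SchemeOver ℂ) (_ : ∀ i, IsSmoothProjective n (E i))
        (e : ∀ i, E i ⟶ X'),
        π.left.base ⁻¹' Z ⊆ ⋃ i, Set.range (e i).left.base ∧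
        ∀ (q : ℕ) (x' : complexBetti X' q), (∀ i, complexBetti.map (e i) q x' = 0) →
          ∃ V : Set (ComplexPoints X'), IsOpen V ∧
            {P | P.pt ∈ ⋃ i, Set.range (e i).left.base} ⊆ V ∧
            singularCohomology.map ℂ ℂ (subsetIncl V) q x' = 0 := by
  intro n X hX Z hZc hZ1
  classical
  have hZne : Z ≠ Set.univ := by
    -- the generic point of the irreducible `X` has codimension `0`
    haveI := hX.geometricallyIrreducible
    haveI : IrreducibleSpace X.left := GeometricallyIrreducible.irreducibleSpace_of_subsingleton X.hom
    intro hZ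
    have h1 := hZ1 (genericPoint X.left) (hZ ▸ Set.mem_univ _)
    have h0 : Order.coheight (genericPoint X.left) = 0 := by
      rw [Order.coheight_eq_zero]
      intro b _
      exact AlgebraicGeometry.Scheme.le_iff_specializes.2 (genericPoint_specializes b)
    rw [h0] at h1
    exact absurd h1 (by norm_num)
  -- hypotheses of the log resolution on `X`
  haveI := hX.smoothOfRelativeDimension
  haveI : Smooth X.hom := SmoothOfRelativeDimension.smooth (n + 1) X.hom
  haveI := hX.geometricallyIrreducible
  haveI : IrreducibleSpace X.left := GeometricallyIrreducible.irreducibleSpace_of_subsingleton X.hom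
  haveI : IsProper X.hom := IsSmoothProjective.isProper_holds hX
  haveI : IsLocallyNoetherian X.left := LocallyOfFiniteType.isLocallyNoetherian X.hom
  have hXreg : Scheme.IsRegular X.left :=
    Scheme.IsRegular.of_smooth X.hom (Scheme.isRegular_Spec (CommRingCat.of ℂ))
  haveI : IsReduced X.left := hXreg.isReduced
  haveI : IsIntegral X.left := isIntegral_of_irreducibleSpace_of_isReduced X.left
  have hprojX : IsProjectiveOver (Over.mk X.hom) := by
    obtain ⟨N, emb, hemb⟩ := hX.isProjectiveOver
    exact ⟨N, emb, hemb⟩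
  -- the log resolution
  obtain ⟨W', f, E, hint, hreg, hiso, hE, hpre, hprojW'⟩ := hLog X.hom hprojX inferInstance hXreg hZc hZne
  haveI := hint
  haveI := hiso
  obtain ⟨hX', hbir⟩ :=
    isSmoothProjective_and_isBirational_of_modification hX hZc hZne f hreg hprojW'
  set X' : SchemeOver ℂ := Over.mk (f ≫ X.hom) with hX'def
  let π : X' ⟶ X := Over.homMk f rfl
  -- the boundary is not everything: `f⁻¹(X ∖ Z) ≠ ∅` misses it
  have hEne : (⋃ D ∈ E, ((D.support : Set W'))) ≠ Set.univ := by
    set U : X.left.Opens := ⟨Zᶜ, hZc.isOpen_compl⟩ with hUdef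
    have hUne : (U : Set X.left).Nonempty := by
      rw [Set.nonempty_iff_ne_empty]
      intro h
      apply hZne
      have h' : (Zᶜ : Set X.left) = ∅ := h
      rw [← compl_compl Z, h', Set.compl_empty]
    obtain ⟨u, hu⟩ := hUne
    have hsurj : Function.Surjective (f ∣_ U) := (Scheme.homeoOfIso (asIso (f ∣_ U))).surjective
    obtain ⟨u', hu'⟩ := hsurj ⟨u, hu⟩
    have hfu : f u'.1 = u := by
      have := congrArg Subtype.val hu'
      rwa [morphismRestrict_base_coe] at this
    intro hU
    have hmem : (u'.1 : W') ∈ ⋃ D ∈ E, ((D.support : Set W')) := by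
      rw [hU]; exact Set.mem_univ _
    rw [← hpre] at hmem
    have : f u'.1 ∈ Z := hmem
    rw [hfu] at this
    exact hu this
  -- the components as smooth projective subvarieties, Prop. 8.2.7 for them, padding
  obtain ⟨Es, hEs, ι, hι, m, Y, hY, g, hm, hg, hU1, hU2, hU3⟩ := exists_family_of_hasSNC hX' E hE hEne
  haveI := hι
  have H := pullback827_of_snc (hS hX') Es hEs g hg hU2 hU3
  obtain ⟨E', hE', e, hrange, H'⟩ := exists_padded_family hY g hm H
  refine ⟨X', hX', π, hbir, ι, hι, E', hE', e, ?_, H'⟩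
  rw [hrange, ← hU1]
  intro x hx
  have hx' : f x ∈ Z := hx
  have : x ∈ f ⁻¹' Z := hx'
  rw [hpre] at this
  exact this

/-! ### The modification data, `DivisorInduction` and the item from the snc principle -/

/-- **The modification data from the snc principle of two types** (`hS`: on a smooth projective
complex variety a class restricting to zero on the complex points of every member of an snc
boundary vanishes on a neighbourhood of their union — Deligne–Griffiths–Morgan–Sullivan §5–§6,
the snc case of Deligne's Prop. 8.2.7): `modification827_of_snc827_of_logResolution` with its
log-resolution hypothesis discharged by `exists_logResolution_isProjectiveOver`.
[cite: DeligneGriffithsMorganSullivan1975, §5–§6] [cite: DeligneHodgeIII1974, Prop. 8.2.7]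
[cite: Kollar2007, Thm. 3.21 (p. 124)] -/
theorem modification827_of_snc827
    (hS : ∀ ⦃n : ℕ⦄ ⦃X : SchemeOver ℂ⦄, IsSmoothProjective n X →
      ∀ (E : List X.left.IdealSheafData), HasSNC E → ∀ (q : ℕ) (x' : complexBetti X q),
      (∀ D ∈ E, singularCohomology.map ℂ ℂ
        (subsetIncl {Q : ComplexPoints X | Q.pt ∈ ((D.support : Set X.left))}) q x' = 0) →
      ∃ V : Set (ComplexPoints X), IsOpen V ∧
        {Q : ComplexPoints X | Q.pt ∈ ⋃ D ∈ E, ((D.support : Set X.left))} ⊆ V ∧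
        singularCohomology.map ℂ ℂ (subsetIncl V) q x' = 0) :
    ∀ ⦃n : ℕ⦄ ⦃X : SchemeOver ℂ⦄, IsSmoothProjective (n + 1) X → ∀ ⦃Z : Set X.left⦄,
      IsClosed Z → (∀ z ∈ Z, (1 : ℕ∞) ≤ Order.coheight z) →
      ∃ (X' : SchemeOver ℂ) (_ : IsSmoothProjective (n + 1) X') (π : X' ⟶ X)
        (_ : Literature.AlgebraicGeometry.Resolution.IsBirational π.left)
        (ι : Type) (_ : Finite ι) (E : ι → SchemeOver ℂ) (_ : ∀ i, IsSmoothProjective n (E i))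
        (e : ∀ i, E i ⟶ X'),
        π.left.base ⁻¹' Z ⊆ ⋃ i, Set.range (e i).left.base ∧
        ∀ (q : ℕ) (x' : complexBetti X' q), (∀ i, complexBetti.map (e i) q x' = 0) →
          ∃ V : Set (ComplexPoints X'), IsOpen V ∧
            {P | P.pt ∈ ⋃ i, Set.range (e i).left.base} ⊆ V ∧
            singularCohomology.map ℂ ℂ (subsetIncl V) q x' = 0 :=
  modification827_of_snc827_of_logResolution
    (fun _ s hproj hint hreg _ hZ hZne ↦ by
      haveI := hint
      exact exists_logResolution_isProjectiveOver s hproj hreg hZ hZne)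
    hS

/-- **`DivisorInduction` (stmt-HodgeConjecture-1082, route decl) from the snc principle of two
types alone** (`divisorInduction_of_modification827` + `modification827_of_snc827`; Voisin's lift,
log resolution and degree-one descent are theorems of the tree).
[cite: DeligneGriffithsMorganSullivan1975, §5–§6] [cite: DeligneHodgeIII1974, Cor. 8.2.8]
[cite: Kollar2007, Thm. 3.21] -/
theorem divisorInduction_of_snc827
    (hS : ∀ ⦃n : ℕ⦄ ⦃X : SchemeOver ℂ⦄, IsSmoothProjective n X →
      ∀ (E : List X.left.IdealSheafData), HasSNC E → ∀ (q : ℕ) (x' : complexBetti X q),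
      (∀ D ∈ E, singularCohomology.map ℂ ℂ
        (subsetIncl {Q : ComplexPoints X | Q.pt ∈ ((D.support : Set X.left))}) q x' = 0) →
      ∃ V : Set (ComplexPoints X), IsOpen V ∧
        {Q : ComplexPoints X | Q.pt ∈ ⋃ D ∈ E, ((D.support : Set X.left))} ⊆ V ∧
        singularCohomology.map ℂ ℂ (subsetIncl V) q x' = 0) :
    DivisorInduction :=
  divisorInduction_of_modification827 (modification827_of_snc827 hS)

/-- **`MiddleDivisorSupportSuffices` (stmt-HodgeConjecture-10865) from the snc principle of two
types and the pencil crux `PencilReduction` (stmt-HodgeConjecture-1083).** With this recipe the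
item's Hodge-theoretic input outside the pencil step is Prop. 8.2.7 for the members of an snc
boundary only — not Deligne's Prop. 8.2.7 for arbitrary families
(`Deligne1974_ker_pullback_eq_ker_pullback_resolution`), whose reduction to the snc case would in
addition need the injectivity of pull-backs along surjective morphisms.
[cite: Thomas2005Nodes, Prop. 2 (proof)] [cite: DecataldoMigliorini2009, §4 Prop. 4.5]
[cite: DeligneGriffithsMorganSullivan1975, §5–§6] [cite: DeligneHodgeIII1974, Prop. 8.2.7] -/
theorem middleDivisorSupportSuffices_of_snc827
    (hS : ∀ ⦃n : ℕ⦄ ⦃X : SchemeOver ℂ⦄, IsSmoothProjective n X →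
      ∀ (E : List X.left.IdealSheafData), HasSNC E → ∀ (q : ℕ) (x' : complexBetti X q),
      (∀ D ∈ E, singularCohomology.map ℂ ℂ
        (subsetIncl {Q : ComplexPoints X | Q.pt ∈ ((D.support : Set X.left))}) q x' = 0) →
      ∃ V : Set (ComplexPoints X), IsOpen V ∧
        {Q : ComplexPoints X | Q.pt ∈ ⋃ D ∈ E, ((D.support : Set X.left))} ⊆ V ∧
        singularCohomology.map ℂ ℂ (subsetIncl V) q x' = 0)
    (hPen : PencilReduction) : MiddleDivisorSupportSuffices :=
  middleDivisorSupportSuffices_of_modification827 (modification827_of_snc827 hS) hPen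

end Summit.HodgeConjecture.HodgeConjecture.Theorems

end
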